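import Summits.QuantumAdvantage.QuantumAdvantage.Theorems.LinnikCubicClassGroupsDegreeOnePrimesEscapeShortIntervalWindow
import HarnessLib

/-!
# Prime ideals of a class in short intervals, VIa: the error of one window with the exceptional zeros kept

Topic `Summits/QuantumAdvantage/QuantumAdvantage/Theorems`, cell B2b-1 (linnik-cubic), PART A (gen 5);
helper for the crux `DegreeOnePrimesEscape` (stmt-QuantumAdvantage-11543) of route
`LinnikCubicClassGroups`.  HONEST FRAMING: the value of this file is a THEOREM (kernel-checked lemma)
— NOT summit progress.

* `window_error_le_exc` — the general-degree form of `window_error_le` (file IIIc): the same error bound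
  `x η/8` for `‖h_K ψ̃_C(g) − F(−1) + Σ_ψ ψ(C⁻¹) Σ_{ρ ∈ Exc ψ} m_ψ(ρ) F(−ρ)‖` with prescribed finite sets
  `Exc ψ` of non-trivial zeros containing those on the exceptional segment (no odd-degree hypothesis);
* `fordLaplace_windowTest_real_mem_Icc` — `0 ≤ F(−σ) ≤ F(−1)` for real `σ ≤ 1`;
* `classGroupChar_inv_eq_neg_one` — `χ(C) = −1 ⇒ χ(C⁻¹) = −1` for a real character.
-/

noncomputable section

open Complex Real MeasureTheory Set Filter Topology
open scoped NumberField nonZeroDivisors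

namespace Summit.QuantumAdvantage.QuantumAdvantage.Theorems.DegreeOnePrimesEscape

open Literature.NumberTheory.LFunctions Literature.NumberTheory.LFunctions.NumberField
  Literature.NumberTheory.LFunctions.EntireEF Literature.NumberTheory.LFunctions.WindowWeight
  Literature.NumberTheory.LFunctions.AbelianDensity

variable {K : Type} [Field K] [NumberField K]

/-! ### The error of one window with the exceptional zeros kept -/

set_option maxHeartbeats 1600000 in
/-- **The error of one window, exceptional zeros kept** (the general-degree form of `window_error_le`):
same hypotheses except that instead of "no zero on the exceptional segment" finite sets `Exc ψ` of
non-trivial zeros of `F_ψ` containing all zeros on the segment are given; conclusion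
`‖h_K ψ̃_C(g) − F(−1) + Σ_ψ ψ(C⁻¹) Σ_{ρ ∈ Exc ψ} m_ψ(ρ) F(−ρ)‖ ≤ x η / 8`. -/
theorem window_error_le_exc {n : ℕ} (hn : 1 < n) (hKn : Module.finrank ℚ K = n)
    {b D a : ℝ} (hb : 0 < b) (hD : 0 < D) (ha : 1 ≤ a)
    (hdens : ∀ (T : ℝ), 1 ≤ T → ∀ u : AddChar (Additive (ClassGroup (𝓞 K))) ℂ → Finset ℂ,
        (∀ ψ, ∀ ρ ∈ u ψ, famF K ψ ρ = 0 ∧ 1 / 4 ≤ ρ.re ∧ ρ.re < 1 ∧ |ρ.im| ≤ T) →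
        ∀ α : ℝ, α ≤ 1 →
          ∑ ψ, ∑ ρ ∈ u ψ with α ≤ ρ.re, (famMult K ψ ρ : ℝ) ≤
            D * Real.exp (b * (a * Real.log (ThornerZaman.condQn K) + Real.log (T + 4))) ^ (1 - α))
    {c : ℝ} (hc : 0 < c)
    (hpack : ∀ (χ : ClassGroup (𝓞 K) →* ℂˣ) (ρ : ℂ),
      (((χ = 1 → dedekindZeta₁ K ρ = 0) ∧ (χ ≠ 1 → classGroupLFunction₀ K χ ρ = 0)) ∧
        1 - c / (Real.log ((NumberField.discr K).natAbs : ℝ) + Real.log (|ρ.im| + 4)) < ρ.re) →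
        ρ.im = 0 ∧ χ * χ = 1)
    {M : ℝ} (hM1 : 1 ≤ M)
    (hM : ∀ y : ℝ, |iteratedDeriv 1 Real.smoothTransition y| ≤ M ∧ |iteratedDeriv 2 Real.smoothTransition y| ≤ M)
    {A_L : ℝ} (hAL : 0 < A_L)
    (hA : ∀ (K' : Type) [Field K'] [NumberField K'] (χ : ClassGroup (𝓞 K') →* ℂˣ) (t : ℝ),
      ‖logDeriv (classGroupLFunction K' χ) (-1 / 2 + t * I)‖ ≤
        A_L * (Module.finrank ℚ K' + 1) * (Real.log ((NumberField.discr K').natAbs : ℝ) + Real.log (|t| + 4)))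
    {θ : ℝ} (hθ0 : 0 < θ) (hθb : θ * b ≤ 1 / 8) (hθ1 : θ ≤ 1 / 8)
    (hθflat : 2 * Real.exp 1 * D * Real.exp (-(c / (6 * θ))) ≤ 1 / 64)
    {x η : ℝ} (hQx : ThornerZaman.condQn K ≤ x)
    (haθ : a * Real.log (ThornerZaman.condQn K) ≤ θ * Real.log x) (h2θ : 2 ≤ θ * Real.log x)
    (hη0 : 0 < η) (hη1 : η ≤ Real.log 2) (hηx : Real.exp (-(θ / 8) * Real.log x) ≤ 2 * η)
    (habs : (338 * (512 * ((n : ℝ) + 1)) + 96 * M * (512 * ((n : ℝ) + 1)) * (4 * tailConst₁ + tailConst₂) + 108 +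
        640 * leftLineConst * A_L * M) * ThornerZaman.condQn K ^ (7 : ℕ) * (Real.log x + 1) *
        Real.exp (-(θ / 4) * Real.log x) ≤ 1 / 32)
    {lo hi : ℝ} (hlo : Real.log x ≤ lo) (hlohi : lo < hi) (hhi : hi ≤ Real.log x + η)
    (C : ClassGroup (𝓞 K)) (Exc : AddChar (Additive (ClassGroup (𝓞 K))) ℂ → Finset ℂ)
    (hExc : ∀ ψ, ∀ ρ ∈ Exc ψ, famF K ψ ρ = 0 ∧ 0 < ρ.re ∧ ρ.re < 1)
    (hExc' : ∀ ψ ρ, famF K ψ ρ = 0 → 0 < ρ.re → ρ.re < 1 → excRegion c K ρ → ρ ∈ Exc ψ) :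
    ‖(NumberField.classNumber K : ℂ) * (smoothedPsiClass K C (windowTest lo hi (η / 4)) : ℂ) -
        fordLaplace (windowTest lo hi (η / 4)) (-1) +
        ∑ ψ : AddChar (Additive (ClassGroup (𝓞 K))) ℂ, ψ (Additive.ofMul C⁻¹) *
          ∑ ρ ∈ Exc ψ, (famMult K ψ ρ : ℂ) * fordLaplace (windowTest lo hi (η / 4)) (-ρ)‖ ≤ x * η / 8 := by
  classical
  obtain ⟨hc₁16, hc₂0⟩ := tailConst_nonneg
  have hlC := leftLineConst_nonneg
  have hK : 1 < Module.finrank ℚ K := by rw [hKn]; exact hn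
  have hQ12 : (12 : ℝ) ≤ ThornerZaman.condQn K := ThornerZaman.twelve_le_condQn (K := K) hK
  have hx0 : 0 < x := by linarith
  have hxexp : Real.exp (Real.log x) = x := Real.exp_log hx0
  -- `L ≥ 16`, hence `ε = η/4 < lo`
  have hlog2 : Real.log 2 < 0.6931471808 := Real.log_two_lt_d9
  have hθL8 : θ * Real.log x ≤ Real.log x / 8 := by
    have hL0' : 0 ≤ Real.log x := Real.log_nonneg (by linarith)
    have := mul_le_mul_of_nonneg_right hθ1 hL0'; linarith
  set ε : ℝ := η / 4 with hε
  have hε0 : 0 < ε := by positivity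
  have hεlo : ε < lo := by rw [hε]; linarith
  set ℓ : ℝ := hi - lo + 2 * ε with hℓ
  have hℓ0 : 0 < ℓ := by rw [hℓ]; linarith
  set LX : ℝ := hi + ε with hLX
  set X : ℝ := Real.exp LX with hX
  set T₁ : ℝ := Real.exp (θ * LX) with hT₁
  have hLX0 : 0 ≤ LX := by
    have : 0 ≤ Real.log x := Real.log_nonneg (by linarith)
    rw [hLX]; linarith
  have hT₁1 : 1 ≤ T₁ := Real.one_le_exp (mul_nonneg hθ0.le hLX0)
  -- the range condition
  have hrange : Real.exp (b * (a * Real.log (ThornerZaman.condQn K) + Real.log (T₁ + 4))) ≤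
      Real.exp (hi + ε) ^ ((1 : ℝ) / 2) :=
    window_range hb hθ0 hθb hθ1 haθ h2θ hη0 hlo hlohi hε hLX hT₁
  -- sizes of the field data
  have hnQ : (Module.finrank ℚ K : ℝ) ≤ ThornerZaman.condQn K := ThornerZaman.finrank_le_condQn (K := K)
  have hhK : (NumberField.classNumber K : ℝ) ≤ ThornerZaman.condQn K ^ (4 : ℕ) :=
    ThornerZaman.classNumber_le_condQn_pow (K := K) hK
  have hAK4 : Real.log ((NumberField.discr K).natAbs : ℝ) + 3 * Module.finrank ℚ K ≤
      4 * ThornerZaman.condQn K := windowConst_le_condQn K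
  have hlogd0 : 0 ≤ Real.log ((NumberField.discr K).natAbs : ℝ) := Real.log_natCast_nonneg _
  -- the two-sided smoothed estimate with the exceptional zeros `Exc`
  have hsm := norm_classNumber_mul_smoothedPsiClass_window_sub_le (K := K) (c := c) hε0 hεlo hlohi C
    Exc hExc hExc'
    (fun u hu ↦ fam_zeroSum_window_le_local hb hD ha hK hdens hc hpack hM hε0 hεlo hlohi hT₁1 hrange u hu)
    (M₀ := 64 * ThornerZaman.condQn K * ℓ)
    (fun ψ ↦ ?_)
    (norm_dzEFRemainder_windowTest_zero_le hAL hA hM hε0 hεlo hlohi)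
    (fun ψ hψ ↦ norm_cgEFRemainder_windowTest_zero_le hAL hA (toHomUnits_ne_one hψ) hM hε0 hεlo hlohi)
  swap
  · -- the trivial-zero multiplicities: `m_ψ(0) ≤ 8(log|d_K| + 6n + 3) ≤ 64 Q`
    have hm : (famMult K ψ 0 : ℝ) ≤ 64 * ThornerZaman.condQn K := by
      by_cases hψ : ψ = 0
      · subst hψ
        rw [famMult, famF_zero]
        refine (analyticOrderNatAt_dedekindZeta₁_zero_le (K := K)).trans ?_
        linarith
      · rw [famMult, famF_of_ne hψ]
        refine (analyticOrderNatAt_classGroupLFunction₀_zero_le (toHomUnits_ne_one hψ)).trans ?_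
        linarith
    have := mul_le_mul_of_nonneg_right hm hℓ0.le
    linarith
  refine hsm.trans ?_
  rw [← hxexp]
  exact window_bookkeeping (W₀ := 512 * ((Module.finrank ℚ K : ℝ) + 1))
    (AK := Real.log ((NumberField.discr K).natAbs : ℝ) + 3 * Module.finrank ℚ K)
    hQ12 hM1 hAL (by positivity) hlC hc₁16 hc₂0 hD hc ha hhK (Nat.cast_nonneg _) rfl hAK4 hlogd0 hnQ
    (Nat.cast_nonneg _) hθ0 hθ1 hθflat haθ h2θ hη0 hη1 hηx (by rw [hKn]; exact habs) hlo hlohi hhi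
    hε hℓ hLX hX hT₁



/-! ### `F(−σ)` for real `σ ≤ 1` -/

/-- For the window weight and real `σ ≤ 1`: `F(−σ)` is real with `0 ≤ F(−σ) ≤ F(−1)`
(`0 < ε ≤ lo ≤ hi`). [folklore] -/
theorem fordLaplace_windowTest_real_mem_Icc {lo hi ε σ : ℝ} (hε : 0 < ε) (hεlo : ε ≤ lo) (hlohi : lo ≤ hi)
    (hσ : σ ≤ 1) :
    (fordLaplace (windowTest lo hi ε) (-(σ : ℂ))).im = 0 ∧
      0 ≤ (fordLaplace (windowTest lo hi ε) (-(σ : ℂ))).re ∧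
      (fordLaplace (windowTest lo hi ε) (-(σ : ℂ))).re ≤ (fordLaplace (windowTest lo hi ε) (-(1 : ℂ))).re := by
  have hb : 0 ≤ hi + ε := by linarith
  have h1 := fordLaplace_windowTest_ofReal (a := lo) (b := hi) hε hb σ
  have h2 := fordLaplace_windowTest_ofReal (a := lo) (b := hi) hε hb 1
  push_cast at h2
  simp only [one_mul] at h2
  rw [h1, h2, Complex.ofReal_im, Complex.ofReal_re, Complex.ofReal_re]
  have hgc : Continuous (windowTest lo hi ε) := windowTest_continuous lo hi ε
  refine ⟨rfl, ?_, ?_⟩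
  · exact intervalIntegral.integral_nonneg hb fun u _ ↦
      mul_nonneg (windowTest_nonneg _ _ _ u) (Real.exp_pos _).le
  · refine intervalIntegral.integral_mono_on hb ?_ ?_ fun u hu ↦ ?_
    · exact (hgc.mul (Real.continuous_exp.comp (continuous_const.mul continuous_id))).intervalIntegrable _ _
    · exact (hgc.mul Real.continuous_exp).intervalIntegrable _ _
    · refine mul_le_mul_of_nonneg_left (Real.exp_le_exp.2 ?_) (windowTest_nonneg _ _ _ u)
      nlinarith [hu.1]

omit [NumberField K] in
/-- A real class group character takes the value `−1` at `C⁻¹` iff at `C`. [folklore] -/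
theorem classGroupChar_inv_eq_neg_one {χ : ClassGroup (𝓞 K) →* ℂˣ} (hχ : χ * χ = 1) {C : ClassGroup (𝓞 K)}
    (hC : (χ C : ℂ) = -1) : (χ C⁻¹ : ℂ) = -1 := by
  have h1 : χ C⁻¹ = (χ C)⁻¹ := map_inv χ C
  have h2 : χ C * χ C = 1 := by rw [← MonoidHom.mul_apply, hχ, MonoidHom.one_apply]
  have h3 : (χ C)⁻¹ = χ C := by
    rw [inv_eq_iff_mul_eq_one, h2]
  rw [h1, h3, hC]

end Summit.QuantumAdvantage.QuantumAdvantage.Theorems.DegreeOnePrimesEscape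

end
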